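import Literature.Probability.RandomPlanarGeometry.SAWQuantitativeHW
import Literature.Probability.RandomPlanarGeometry.SAWSubexponentialBounds
import HarnessLib

/-!
# Hutchcroft 2018, Theorem 1.2 (`c_n ≤ exp[o(√n)] μⁿ`) from the Duminil-Copin–Hammond bridge theorem

Topic `Literature/Probability/RandomPlanarGeometry` (continues `SAWQuantitativeHW.lean`: the windowed
bridge-height-decay hypothesis `BridgeHeightDecayWindow d ℓ A c` and Theorem 1.4 in finite form,
`count_le_of_heightDecayWindow`; and `SAWSubexponentialBounds.lean`: the named fact
`Hutchcroft2018_thm12`). Sources: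

* H. Duminil-Copin, A. Hammond, *Self-avoiding walk is sub-ballistic*, Comm. Math. Phys. 324 (2013)
  401–423 (arXiv:1205.0401), §2.4: "**Ballistic assumption.** Suppose that for some `v > 0`,
  `limsup_{n→∞} n^{-1} log P_{SAB_n}(y(γ_n) ≥ vn) = 0`" … "Therefore, if the conclusion of Theorem 1.1
  is violated, the ballistic assumption must be verified. Corollary 2.4 then contradicts Theorem 2.5."
  — i.e. the paper PROVES, for every `d ≥ 2` and `v > 0`, `limsup n^{-1} log P_{SAB_n}(y(γ_n) ≥ vn) < 0`
  (restated by Hutchcroft as his Theorem 1.3). `P_{SAB_n}` is the uniform law on `n`-step bridges, `y`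
  the bridge coordinate (the tree's bridges use the FIRST coordinate; same objects up to a permutation
  of coordinates), so the event has probability `#{ω ∈ bridges d n : vn ≤ ω n 0}/bₙ`.
* T. Hutchcroft, Electron. Commun. Probab. 23 (2018) no. 5 (arXiv:1708.09460), Theorem 1.2: "Let
  `d ≥ 2`. Then `c_n ≤ exp[o(n^{1/2})] μ_c^n` as `n → ∞`"; proof (§2.2): "It suffices to prove that
  `Ψ(n) = o(n^{1/2})` … Setting `ε = δ n^{-1/2}` yields … `Ψ(n) ≤ (δ + 2/(δM)) n^{1/2} + o(n^{1/2})`".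

## Contents (namespace `Literature.Probability.RandomPlanarGeometry.SAW.Zd`)

* `DuminilCopinHammond2013_bridgeNotBallistic` — NAMED FACT (the negation of DC–H's Ballistic
  assumption, which their §2.4 proves): `∀ d ≥ 2, ∀ v > 0, ∃ c > 0, ∃ n₀, ∀ n ≥ n₀,
  #{ω ∈ bridges d n : vn ≤ ω n 0} ≤ e^{-cn} bₙ`;
* `window_of_bridgeNotBallistic` — PROVED: the fact gives, for every `ℓ ≥ 1`, a window hypothesis
  `BridgeHeightDecayWindow d ℓ A c` with some `c > 0` (`v = 1/ℓ`, prefactor `A = e^{c n₀}` absorbing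
  the finitely many short lengths);
* **`isLittleO_of_windows`** — PROVED: windows at every scale `ℓ` ⇒ `log(cₙ/μⁿ) = o(√n)` (Hutchcroft's
  `Ψ(n) = o(n^{1/2})` computation: `ε = a/√n`, `ℓ ≥ 256/δ²`, `a = δ/16`);
* **`Hutchcroft2018_thm12_of_bridgeNotBallistic`** — PROVED: the DC–H fact implies the tree's named
  fact `Hutchcroft2018_thm12` (so the latter's trust base is now the primary theorem it rests on).
* **`DuminilCopinHammond2013_bridgeNotBallistic_of_thm1_1`** — PROVED: Duminil-Copin–Hammond's
  Theorem 1.1 AS PRINTED (all walks, event `max_k ‖γ_k‖ ≥ vn`; tree fact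
  `DuminilCopinHammond2013_thm1_1`) implies the bridge fact, via `bₙ ≥ μⁿe^{-c√n}` and `cₙ ≤ μⁿe^{κ√n}`;
  hence **`Hutchcroft2018_thm12_of_thm1_1`**: Theorem 1.2 from Theorem 1.1 alone.
-/

noncomputable section

open Finset Filter Topology Asymptotics Literature.Probability.LatticeModels
  Literature.Probability.Percolation
open scoped BigOperators

namespace Literature.Probability.RandomPlanarGeometry.SAW.Zd

variable {d : ℕ} [NeZero d]

/-- NAMED FACT — **Duminil-Copin–Hammond 2013: bridges are not ballistic** (the negation of the
"Ballistic assumption" of §2.4, established there from Corollary 2.4 and Theorem 2.5; = Hutchcroft 2018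
Theorem 1.3 in eventual form): for every `d ≥ 2` and `v > 0` there are `c > 0` and `n₀` with
`#{ω ∈ bridges d n : v n ≤ ω n 0} ≤ e^{-c n} bₙ` for all `n ≥ n₀`. Users take it as a hypothesis.
[cite: DuminilCopinHammond2013, §2.4 (Ballistic assumption and its refutation via Cor. 2.4 + Thm. 2.5)] -/
def DuminilCopinHammond2013_bridgeNotBallistic : Prop :=
  ∀ (d : ℕ) [NeZero d], 2 ≤ d → ∀ v : ℝ, 0 < v → ∃ c : ℝ, 0 < c ∧ ∃ n₀ : ℕ, ∀ n : ℕ, n₀ ≤ n →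
    (((bridges d n).filter fun ω => v * (n : ℝ) ≤ ((ω n 0 : ℤ) : ℝ)).card : ℝ) ≤
      Real.exp (-(c * n)) * (bridgeCount d n : ℝ)

/-- **DC–H's theorem supplies a window at every scale**: for `ℓ ≥ 1`, taking `v = 1/ℓ`, every length
`m ≥ n₀` in the window `n ≤ m ≤ ℓ n` has `#{height ≥ n} ≤ e^{-cm} b_m ≤ e^{-cn} b_m`, and the finitely
many `m < n₀` are absorbed by the prefactor `A = e^{c n₀}`.
[cite: DuminilCopinHammond2013, §2.4; Hutchcroft2018HammersleyWelsh, Theorem 1.3] -/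
theorem window_of_bridgeNotBallistic (h : DuminilCopinHammond2013_bridgeNotBallistic) (hd : 2 ≤ d)
    {ℓ : ℕ} (hℓ : 1 ≤ ℓ) : ∃ A c : ℝ, 0 < c ∧ BridgeHeightDecayWindow d ℓ A c := by
  have hℓ0 : (0 : ℝ) < ℓ := by exact_mod_cast hℓ
  obtain ⟨c, hc, n₀, hn₀⟩ := h d hd (1 / (ℓ : ℝ)) (by positivity)
  refine ⟨Real.exp (c * n₀), c, hc, fun m n hn hnm hmℓ => ?_⟩
  -- the height-`n` event is contained in DC–H's event at `v = 1/ℓ` (`m/ℓ ≤ n`)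
  have hsub : ((bridges d m).filter fun ω => (n : ℤ) ≤ ω m 0) ⊆
      (bridges d m).filter fun ω => 1 / (ℓ : ℝ) * (m : ℝ) ≤ ((ω m 0 : ℤ) : ℝ) := by
    intro ω hω
    rw [Finset.mem_filter] at hω ⊢
    refine ⟨hω.1, le_trans ?_ (by exact_mod_cast hω.2 : ((n : ℤ) : ℝ) ≤ ((ω m 0 : ℤ) : ℝ))⟩
    rw [one_div, inv_mul_le_iff₀ hℓ0]
    have : ((m : ℕ) : ℝ) ≤ ((ℓ * n : ℕ) : ℝ) := by exact_mod_cast hmℓ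
    push_cast at this ⊢
    linarith
  have hcard : (((bridges d m).filter fun ω => (n : ℤ) ≤ ω m 0).card : ℝ) ≤
      (((bridges d m).filter fun ω => 1 / (ℓ : ℝ) * (m : ℝ) ≤ ((ω m 0 : ℤ) : ℝ)).card : ℝ) := by
    exact_mod_cast Finset.card_le_card hsub
  have hb0 : (0 : ℝ) ≤ (bridgeCount d m : ℝ) := Nat.cast_nonneg _
  have hnm' : (n : ℝ) ≤ m := by exact_mod_cast hnm
  rcases le_or_gt n₀ m with hm0 | hm0
  · -- long lengths: DC–H applies
    calc (((bridges d m).filter fun ω => (n : ℤ) ≤ ω m 0).card : ℝ)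
        ≤ Real.exp (-(c * m)) * (bridgeCount d m : ℝ) := hcard.trans (hn₀ m hm0)
      _ ≤ Real.exp (-(c * n)) * (bridgeCount d m : ℝ) := by
          refine mul_le_mul_of_nonneg_right (Real.exp_le_exp.2 ?_) hb0
          nlinarith
      _ ≤ Real.exp (c * n₀) * (bridgeCount d m : ℝ) * Real.exp (-(c * n)) := by
          rw [mul_comm (Real.exp (-(c * n))), mul_assoc]
          refine le_mul_of_one_le_left (by positivity) ?_
          exact Real.one_le_exp (by positivity)
  · -- short lengths `m < n₀`: trivial bound `≤ b_m`, prefactor `e^{c n₀} e^{-c n} ≥ 1`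
    have h1 : (((bridges d m).filter fun ω => (n : ℤ) ≤ ω m 0).card : ℝ) ≤ (bridgeCount d m : ℝ) := by
      exact_mod_cast Finset.card_le_card (Finset.filter_subset _ (bridges d m))
    refine h1.trans ?_
    have hnn₀ : (n : ℝ) ≤ n₀ := by exact_mod_cast (hnm.trans hm0.le)
    calc (bridgeCount d m : ℝ) = 1 * (bridgeCount d m : ℝ) * 1 := by ring
      _ ≤ Real.exp (c * n₀) * (bridgeCount d m : ℝ) * Real.exp (-(c * n)) := by
          rw [show Real.exp (c * n₀) * (bridgeCount d m : ℝ) * Real.exp (-(c * n)) =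
              Real.exp (c * n₀ + -(c * n)) * (bridgeCount d m : ℝ) * 1 by rw [Real.exp_add]; ring]
          gcongr
          exact Real.one_le_exp (by nlinarith)

/-- `u/2 ≤ 1 - e^{-u}` for `0 ≤ u ≤ 1`. [folklore] -/
private theorem half_le_one_sub_exp_neg' {u : ℝ} (hu0 : 0 ≤ u) (hu1 : u ≤ 1) :
    u / 2 ≤ 1 - Real.exp (-u) := by
  have h1 : Real.exp (-u) * (1 + u) ≤ 1 := by
    calc Real.exp (-u) * (1 + u) ≤ Real.exp (-u) * Real.exp u := by
          refine mul_le_mul_of_nonneg_left ?_ (Real.exp_nonneg _)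
          linarith [Real.add_one_le_exp u]
      _ = 1 := by rw [← Real.exp_add, neg_add_cancel, Real.exp_zero]
  nlinarith [Real.exp_pos (-u)]

/-- `-log(1 - ε) ≤ 2ε` for `0 ≤ ε ≤ 1/2`. [folklore] -/
private theorem neg_log_one_sub_le {ε : ℝ} (hε0 : 0 ≤ ε) (hε1 : ε ≤ 1 / 2) :
    -Real.log (1 - ε) ≤ 2 * ε := by
  have h1 : 0 < 1 - ε := by linarith
  rw [← Real.log_inv, ← Real.log_exp (2 * ε)]
  refine Real.log_le_log (inv_pos.2 h1) ?_
  rw [inv_le_iff_one_le_mul₀ h1]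
  nlinarith [Real.add_one_le_exp (2 * ε)]

/-- **`Ψ(n) = o(n^{1/2})`**: windows at every scale `ℓ ≥ 1` (each with SOME rate `c_ℓ > 0`) give
`log(cₙ/μⁿ) = o(√n)` — with `f(n) := log cₙ - n log μ ≥ 0`, for every `δ > 0`, taking `ℓ ≥ 256/δ²`
and `ε = (δ/16)/√n` in Theorem 1.4 (finite form) yields `f(n) ≤ (δ/2)√n + K_δ ≤ δ√n` for large `n`.
[cite: Hutchcroft2018HammersleyWelsh, proof of Theorem 1.2 (§2.2: "`Ψ(n) ≤ (δ + 2/(δM)) n^{1/2} + o(n^{1/2})`")] -/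
theorem isLittleO_of_windows
    (hw : ∀ ℓ : ℕ, 1 ≤ ℓ → ∃ A c : ℝ, 0 < c ∧ BridgeHeightDecayWindow d ℓ A c) :
    (fun n : ℕ => Real.log (count d n) - n * Real.log (connectiveConstant d)) =o[atTop]
      fun n : ℕ => Real.sqrt (n : ℝ) := by
  set μ : ℝ := connectiveConstant d with hμdef
  have hμ : 0 < μ := connectiveConstant_pos d
  have hμ1 : 1 ≤ μ := one_le_connectiveConstant d
  set f : ℕ → ℝ := fun n => Real.log (count d n) - n * Real.log μ with hf
  -- `f n ≥ 0` (`μⁿ ≤ cₙ`)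
  have hf0 : ∀ n, 0 ≤ f n := by
    intro n
    have hc : (0 : ℝ) < count d n := by exact_mod_cast one_le_count d n
    have := Real.log_le_log (pow_pos hμ n) (pow_connectiveConstant_le_count d n)
    rw [Real.log_pow] at this
    simp only [hf]
    linarith
  rw [Asymptotics.isLittleO_iff]
  intro δ hδ
  -- choose the scale `ℓ` and the window constants
  set a : ℝ := δ / 16 with ha
  have ha0 : 0 < a := by positivity
  obtain ⟨ℓ, hℓ⟩ : ∃ ℓ : ℕ, (256 : ℝ) / δ ^ 2 ≤ ℓ ∧ 1 ≤ ℓ :=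
    ⟨max ⌈(256 : ℝ) / δ ^ 2⌉₊ 1, (Nat.le_ceil _).trans (by exact_mod_cast le_max_left _ _),
      le_max_right _ _⟩
  obtain ⟨hℓδ, hℓ1⟩ := hℓ
  have hℓ0 : (0 : ℝ) < ℓ := by exact_mod_cast hℓ1
  obtain ⟨A, c, hc, hwin⟩ := hw ℓ hℓ1
  set κ : ℝ := 1 - Real.exp (-c) with hκ
  have hκ0 : 0 < κ := by
    rw [hκ, sub_pos]
    exact Real.exp_lt_one_iff.2 (by linarith)
  set K : ℝ := 2 / κ + Real.log μ with hK
  have hK0 : 0 ≤ K := by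
    have := Real.log_nonneg hμ1
    positivity
  -- threshold: `√n ≥ T := max (a ℓ) (max (2a) (2K/δ))`
  set T : ℝ := max (a * ℓ) (max (2 * a) (2 * K / δ)) with hT
  have hT0 : 0 < T := lt_max_of_lt_left (by positivity)
  rw [Filter.eventually_atTop]
  refine ⟨⌈T ^ 2⌉₊ + 1, fun n hn => ?_⟩
  have hn1 : (1 : ℝ) ≤ n := by exact_mod_cast (show 1 ≤ n by omega)
  have hn0 : (0 : ℝ) < n := by linarith
  have hsq : T ≤ Real.sqrt n := by
    rw [Real.le_sqrt' hT0]
    have : (⌈T ^ 2⌉₊ : ℝ) ≤ n := by exact_mod_cast (show ⌈T ^ 2⌉₊ ≤ n by omega)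
    exact (Nat.le_ceil _).trans this
  have hs0 : 0 < Real.sqrt n := Real.sqrt_pos.2 hn0
  have haℓ : a * ℓ ≤ Real.sqrt n := (le_max_left _ _).trans hsq
  have h2a : 2 * a ≤ Real.sqrt n := ((le_max_left _ _).trans (le_max_right _ _)).trans hsq
  have h2K : 2 * K / δ ≤ Real.sqrt n := ((le_max_right _ _).trans (le_max_right _ _)).trans hsq
  -- `ε = a/√n ∈ (0, 1/2]`, `ε ℓ ≤ 1`
  set ε : ℝ := a / Real.sqrt n with hε
  have hε0 : 0 < ε := div_pos ha0 hs0
  have hεh : ε ≤ 1 / 2 := by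
    rw [hε, div_le_iff₀ hs0]; linarith
  have hε1 : ε < 1 := by linarith
  have hεℓ : ε * ℓ ≤ 1 := by
    rw [hε, div_mul_eq_mul_div, div_le_one hs0]; exact haℓ
  -- Theorem 1.4, finite form
  set ρ : ℝ := max ((1 - ε) ^ ℓ) ((1 - ε) * Real.exp (-c)) with hρ
  have key := count_le_of_heightDecayWindow hwin hℓ1 hc.le hε0 hε1 n
  rw [← hρ, ← hμdef] at key
  -- `1 - ρ ≥ min(εℓ/2, κ)`; so `2ρ/(1-ρ) ≤ 4/(εℓ) + 2/κ`
  have hρ0 : 0 ≤ ρ := le_max_of_le_left (pow_nonneg (by linarith) ℓ)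
  have h1ρ₁ : ε * ℓ / 2 ≤ 1 - (1 - ε) ^ ℓ := by
    have e1 : (1 - ε) ^ ℓ ≤ Real.exp (-(ε * ℓ)) := by
      calc (1 - ε) ^ ℓ ≤ Real.exp (-ε) ^ ℓ := pow_le_pow_left₀ (by linarith) (Real.one_sub_le_exp_neg ε) ℓ
        _ = Real.exp (-(ε * ℓ)) := by rw [← Real.exp_nat_mul]; ring_nf
    have e2 := half_le_one_sub_exp_neg' (by positivity : 0 ≤ ε * ℓ) hεℓ
    linarith
  have h1ρ₂ : κ ≤ 1 - (1 - ε) * Real.exp (-c) := by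
    rw [hκ]
    nlinarith [Real.exp_pos (-c), hε0]
  have hρ1 : ρ < 1 := by
    rcases le_total ((1 - ε) ^ ℓ) ((1 - ε) * Real.exp (-c)) with h | h
    · rw [hρ, max_eq_right h]; linarith
    · rw [hρ, max_eq_left h]; linarith [mul_pos hε0 hℓ0]
  have hfrac : 2 * (ρ / (1 - ρ)) ≤ 4 / (ε * ℓ) + 2 / κ := by
    have hpos : 0 < 1 - ρ := by linarith
    have e0 : ρ / (1 - ρ) ≤ 1 / (1 - ρ) := div_le_div_of_nonneg_right hρ1.le hpos.le
    rcases le_total ((1 - ε) ^ ℓ) ((1 - ε) * Real.exp (-c)) with h | h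
    · have : 1 - ρ ≥ κ := by rw [hρ, max_eq_right h]; exact h1ρ₂
      have e1 : 1 / (1 - ρ) ≤ 1 / κ := one_div_le_one_div_of_le hκ0 this
      have e2 : 0 ≤ 4 / (ε * ℓ) := by positivity
      have e3 : 2 * (ρ / (1 - ρ)) ≤ 2 / κ := by
        have := mul_le_mul_of_nonneg_left (e0.trans e1) (show (0 : ℝ) ≤ 2 by norm_num)
        calc 2 * (ρ / (1 - ρ)) ≤ 2 * (1 / κ) := this
          _ = 2 / κ := by ring
      linarith
    · have : 1 - ρ ≥ ε * ℓ / 2 := by rw [hρ, max_eq_left h]; exact h1ρ₁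
      have e1 : 1 / (1 - ρ) ≤ 1 / (ε * ℓ / 2) := one_div_le_one_div_of_le (by positivity) this
      have e2 : 0 ≤ 2 / κ := by positivity
      have e3 : 2 * (ρ / (1 - ρ)) ≤ 4 / (ε * ℓ) := by
        have := mul_le_mul_of_nonneg_left (e0.trans e1) (show (0 : ℝ) ≤ 2 by norm_num)
        calc 2 * (ρ / (1 - ρ)) ≤ 2 * (1 / (ε * ℓ / 2)) := this
          _ = 4 / (ε * ℓ) := by field_simp; ring
      linarith
  -- take logarithms in `key`
  have hcpos : (0 : ℝ) < count d n := by exact_mod_cast one_le_count d n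
  have h1ε : 0 < 1 - ε := by linarith
  have hlog : f n ≤ 2 * (ρ / (1 - ρ)) + Real.log μ + (n + 1) * (-Real.log (1 - ε)) := by
    have := Real.log_le_log hcpos key
    rw [Real.log_div (by positivity) (by positivity), Real.log_mul (by positivity) (by positivity),
      Real.log_exp, Real.log_pow, Real.log_pow] at this
    simp only [hf]
    push_cast at this ⊢
    linarith
  -- assemble: `f n ≤ 4/(εℓ) + 2/κ + log μ + 2ε(n+1) ≤ (δ/2)√n + K ≤ δ √n`
  have hnlog : (n + 1 : ℝ) * (-Real.log (1 - ε)) ≤ 4 * a * Real.sqrt n := by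
    have e1 := neg_log_one_sub_le hε0.le hεh
    have e2 : (n + 1 : ℝ) ≤ 2 * n := by linarith
    have e3 : ε * n = a * Real.sqrt n := by
      rw [hε, div_mul_eq_mul_div, mul_div_assoc, Real.div_sqrt]
    calc (n + 1 : ℝ) * (-Real.log (1 - ε)) ≤ (2 * n) * (2 * ε) :=
          mul_le_mul e2 e1 (by linarith [Real.log_le_sub_one_of_pos h1ε]) (by positivity)
      _ = 4 * (ε * n) := by ring
      _ = 4 * a * Real.sqrt n := by rw [e3]; ring
  have hmain : 4 / (ε * ℓ) ≤ (δ / 4) * Real.sqrt n := by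
    -- `4/(εℓ) = 4√n/(aℓ) ≤ (δ/4)√n` iff `ℓ ≥ 16/(aδ) = 256/δ²`
    have haδℓ : (16 : ℝ) ≤ a * δ * ℓ := by
      have hδ2 : 0 < δ ^ 2 := by positivity
      have h1 : (256 : ℝ) ≤ (ℓ : ℝ) * δ ^ 2 := (div_le_iff₀ hδ2).1 hℓδ
      have h2 : a * δ * ℓ = (ℓ : ℝ) * δ ^ 2 / 16 := by rw [ha]; ring
      rw [h2]
      linarith
    have eq1 : 4 / (ε * ℓ) = (4 / (a * ℓ)) * Real.sqrt n := by
      rw [hε]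
      field_simp
    rw [eq1]
    refine mul_le_mul_of_nonneg_right ?_ (Real.sqrt_nonneg _)
    rw [div_le_iff₀ (by positivity)]
    have h3 : δ / 4 * (a * ℓ) = a * δ * ℓ / 4 := by ring
    rw [h3]
    linarith
  have hKs : K ≤ (δ / 2) * Real.sqrt n := by
    rw [div_le_iff₀ hδ] at h2K
    linarith
  have htot : f n ≤ δ * Real.sqrt n := by
    have : 4 * a * Real.sqrt n = (δ / 4) * Real.sqrt n := by rw [ha]; ring
    linarith [hlog, hfrac, hnlog, hmain, hKs]
  rw [Real.norm_of_nonneg (hf0 n), Real.norm_of_nonneg (Real.sqrt_nonneg _)]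
  exact htot

/-- **Hutchcroft 2018, Theorem 1.2, from the Duminil-Copin–Hammond bridge theorem**: the named fact
`DuminilCopinHammond2013_bridgeNotBallistic` implies the tree's named fact `Hutchcroft2018_thm12`
(`∀ d ≥ 2, ∃ f = o(√n), ∀ n, cₙ ≤ e^{f(n)} μⁿ`), with `f(n) = log cₙ - n log μ`.
[cite: Hutchcroft2018HammersleyWelsh, Theorem 1.2 (proof §2.2)] -/
theorem Hutchcroft2018_thm12_of_bridgeNotBallistic (h : DuminilCopinHammond2013_bridgeNotBallistic) :
    Hutchcroft2018_thm12 := by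
  intro d _ hd
  refine ⟨fun n => Real.log (count d n) - n * Real.log (connectiveConstant d),
    isLittleO_of_windows fun ℓ hℓ => window_of_bridgeNotBallistic h hd hℓ, fun n => ?_⟩
  have hc : (0 : ℝ) < count d n := by exact_mod_cast one_le_count d n
  have hμ := connectiveConstant_pos d
  rw [Real.exp_sub, Real.exp_log hc, ← Real.log_pow, Real.exp_log (pow_pos hμ n),
    div_mul_cancel₀ _ (pow_pos hμ n).ne']

/-! ### The bridge fact from Duminil-Copin–Hammond's Theorem 1.1 as printed

Duminil-Copin–Hammond state Theorem 1.1 for ALL `n`-step self-avoiding walks and the event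
`max_{k ≤ n} ‖γ_k‖ ≥ vn` (tree: `DuminilCopinHammond2013_thm1_1`, file `SAWSubBallistic.lean`). A bridge
with `ω_n` at height `≥ vn` belongs to that event (`‖ω_n‖ ≥ |x₁(ω_n)|`), bridges are walks, and
`cₙ ≤ μⁿ e^{κ√n}` (Hammersley–Welsh, `BDGS2012_HammersleyWelsh_holds`) while `bₙ ≥ μⁿ e^{-c√n}`
(`exp_mul_pow_le_bridgeCount`); so `#{bridges of height ≥ vn} ≤ e^{-εn} cₙ ≤ e^{-εn + (κ+c)√n} bₙ
≤ e^{-(ε/2) n} bₙ` for large `n`. Hence the walk theorem implies the bridge fact, and Hutchcroft's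
Theorem 1.2 rests on Theorem 1.1 alone. -/

/-- `|x₁(u)| ≤ ‖u‖` (one coordinate is dominated by the Euclidean norm).
[cite: DuminilCopinHammond2013, §1.1 (‖·‖ the Euclidean norm)] -/
theorem abs_apply_zero_le_euclidNorm (u : Site d) : |((u 0 : ℤ) : ℝ)| ≤ euclidNorm u := by
  rw [euclidNorm, ← Real.sqrt_sq_eq_abs]
  exact Real.sqrt_le_sqrt (Finset.single_le_sum (f := fun i => ((u i : ℤ) : ℝ) ^ 2)
    (fun i _ => sq_nonneg _) (Finset.mem_univ (0 : Fin d)))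

omit [NeZero d] in
/-- **Duminil-Copin–Hammond's Theorem 1.1 (walks, as printed) implies the bridge fact**
`DuminilCopinHammond2013_bridgeNotBallistic` (every `d ≥ 2`, `v > 0`; rate `ε/2` for DC–H's `ε`).
[cite: DuminilCopinHammond2013, Theorem 1.1 and §2.4; MadrasSlade1993, Theorem 3.1.1 and Corollary 3.1.6 (the two `e^{O(√n)}` envelopes)] -/
theorem DuminilCopinHammond2013_bridgeNotBallistic_of_thm1_1 (h : DuminilCopinHammond2013_thm1_1) :
    DuminilCopinHammond2013_bridgeNotBallistic := by
  intro d _ hd v hv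
  obtain ⟨ε, hε, n₀, hn₀⟩ := h d hd v hv
  obtain ⟨κ, hκ⟩ := BDGS2012_HammersleyWelsh_holds d hd
  obtain ⟨c₁, hc₁⟩ := exp_mul_pow_le_bridgeCount (d := d)
  set K : ℝ := max 0 (κ + c₁) with hKdef
  have hK0 : 0 ≤ K := le_max_left _ _
  refine ⟨ε / 2, by positivity, max n₀ ⌈(2 * K / ε) ^ 2⌉₊, fun n hn => ?_⟩
  have hn0 : n₀ ≤ n := le_trans (le_max_left _ _) hn
  have hn1 : (2 * K / ε) ^ 2 ≤ (n : ℝ) :=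
    le_trans (Nat.le_ceil _) (by exact_mod_cast le_trans (le_max_right _ _) hn)
  have hμ := connectiveConstant_pos d
  -- the bridge event is inside DC–H's event
  have hsub : ((bridges d n).filter fun ω => v * (n : ℝ) ≤ ((ω n 0 : ℤ) : ℝ)) ⊆
      maxDisplacementEvent d n v := by
    intro ω hω
    rw [Finset.mem_filter] at hω
    rw [mem_maxDisplacementEvent]
    refine ⟨(mem_bridges.1 hω.1).1, n, le_rfl, ?_⟩
    exact hω.2.trans ((le_abs_self _).trans (abs_apply_zero_le_euclidNorm _))
  have h1 : (((bridges d n).filter fun ω => v * (n : ℝ) ≤ ((ω n 0 : ℤ) : ℝ)).card : ℝ) ≤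
      ((maxDisplacementEvent d n v).card : ℝ) := by
    exact_mod_cast Finset.card_le_card hsub
  -- DC–H: `#event ≤ e^{-εn} cₙ`
  have hc : (0 : ℝ) < count d n := by exact_mod_cast one_le_count d n
  have h2 : ((maxDisplacementEvent d n v).card : ℝ) ≤ Real.exp (-(ε * n)) * count d n := by
    have := hn₀ n hn0
    rwa [div_le_iff₀ hc] at this
  -- envelopes: `cₙ ≤ μⁿ e^{κ√n}` and `μⁿ ≤ e^{c₁√n} bₙ`
  have h3 : (count d n : ℝ) ≤ connectiveConstant d ^ n * Real.exp (κ * Real.sqrt n) := hκ n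
  have h4 : connectiveConstant d ^ n ≤ Real.exp (c₁ * Real.sqrt n) * bridgeCount d n := by
    have := hc₁ n
    rw [Real.exp_neg, inv_mul_le_iff₀ (Real.exp_pos _)] at this
    exact this
  have hb : (0 : ℝ) ≤ bridgeCount d n := Nat.cast_nonneg _
  -- exponent bookkeeping: `-εn + (κ + c₁)√n ≤ -(ε/2) n`
  have hsq : 2 * K / ε ≤ Real.sqrt n := by
    rw [← Real.sqrt_sq (by positivity : (0 : ℝ) ≤ 2 * K / ε)]
    exact Real.sqrt_le_sqrt hn1
  have hexp : -(ε * n) + (κ * Real.sqrt n + c₁ * Real.sqrt n) ≤ -(ε / 2 * n) := by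
    have hKs : (κ + c₁) * Real.sqrt n ≤ K * Real.sqrt n :=
      mul_le_mul_of_nonneg_right (le_max_right _ _) (Real.sqrt_nonneg _)
    have hK2 : K * Real.sqrt n ≤ ε / 2 * n := by
      have h' : K ≤ ε / 2 * Real.sqrt n := by
        rw [div_le_iff₀ hε] at hsq
        linarith
      calc K * Real.sqrt n ≤ ε / 2 * Real.sqrt n * Real.sqrt n :=
            mul_le_mul_of_nonneg_right h' (Real.sqrt_nonneg _)
        _ = ε / 2 * n := by
            rw [mul_assoc, Real.mul_self_sqrt (Nat.cast_nonneg n)]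
    nlinarith
  calc (((bridges d n).filter fun ω => v * (n : ℝ) ≤ ((ω n 0 : ℤ) : ℝ)).card : ℝ)
      ≤ Real.exp (-(ε * n)) * count d n := h1.trans h2
    _ ≤ Real.exp (-(ε * n)) * (connectiveConstant d ^ n * Real.exp (κ * Real.sqrt n)) :=
        mul_le_mul_of_nonneg_left h3 (Real.exp_pos _).le
    _ ≤ Real.exp (-(ε * n)) *
          (Real.exp (c₁ * Real.sqrt n) * bridgeCount d n * Real.exp (κ * Real.sqrt n)) := by
        gcongr
    _ = Real.exp (-(ε * n) + (κ * Real.sqrt n + c₁ * Real.sqrt n)) * bridgeCount d n := by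
        rw [Real.exp_add, Real.exp_add]; ring
    _ ≤ Real.exp (-(ε / 2 * n)) * bridgeCount d n :=
        mul_le_mul_of_nonneg_right (Real.exp_le_exp.2 hexp) hb

omit [NeZero d] in
/-- **Hutchcroft 2018, Theorem 1.2, from Duminil-Copin–Hammond's Theorem 1.1 as printed**: the tree's
named fact `Hutchcroft2018_thm12` (`∀ d ≥ 2, ∃ f = o(√n), ∀ n, cₙ ≤ e^{f(n)} μⁿ`) follows from the walk
sub-ballisticity theorem alone. [cite: Hutchcroft2018HammersleyWelsh, Theorem 1.2 (abstract: "a corollary to the sub-ballisticity theorem of Duminil-Copin and Hammond"); DuminilCopinHammond2013, Theorem 1.1] -/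
theorem Hutchcroft2018_thm12_of_thm1_1 (h : DuminilCopinHammond2013_thm1_1) : Hutchcroft2018_thm12 :=
  Hutchcroft2018_thm12_of_bridgeNotBallistic (DuminilCopinHammond2013_bridgeNotBallistic_of_thm1_1 h)

end Literature.Probability.RandomPlanarGeometry.SAW.Zd

end
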